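import Summits.CriticalPhenomena.SAWScalingLimit.Theorems.SAWSpinMonotoneQCIdentificationDefs
import Literature.Probability.LatticeModels.TriangularLatticeProofs
import Literature.Probability.RandomPlanarGeometry.HexParafermionProofs

/-!
# `NoBranching`, step S1 — the algebraic core (helper of `stub_noBranching : NoFoldBound → NoBranching`,
line `eight_fifths_primitive`, crux `QCIdentification`, stmt-CriticalPhenomena-16772)

**What.** Around a vertex `v` of the hexagonal lattice label the three mid-edges `p_k = {v, hexNbr v k}`
counterclockwise and write `F_k = F(p_k)` for the critical parafermionic observable
`F = Fobs Λ a` (vocabulary module `SAWSpinMonotoneQCIdentificationDefs`). The three values are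
recovered from their three discrete Fourier modes
`S = F₀ + F₁ + F₂` (`modeSum`, the `∂H`-mode), `L = F₀ + ωF₁ + ω²F₂` (the Lemma-1 mode) and
`B = F₀ + ωF₂ + ω²F₁` (the Beltrami mode), `ω = e^{2πi/3}`:
`3F_k = S + ω^{-k} L + ω^{k} B` (`three_mul_eq₀/₁/₂`). This file proves:

* the lattice-geometry bridge `hexMidpoint p_k - hexCenter v = c₀(v) · ω^k` with an explicit non-zero
  `c₀(v) = dartCoeff v` (`hexMidpoint_sub_hexCenter`), so that DCS 2012 Lemma 1
  (`DuminilCopinSmirnov2012_lemma1_holds`, `Σ_k (p_k - v) F(p_k) = 0`) reads `L = 0` (`lemma1_mode`);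
* under the no-fold bound (K) (`NoFoldBound`: `‖B‖ ≤ k‖S‖`, `k < 1`, for every labelling): a face with
  `S(v) = 0` carries `F = 0` on all three mid-edges (`fobs_eq_zero_of_modeSum_eq_zero`), a face with
  `S(v) ≠ 0` has all three `F_k ≠ 0` (`fobs_ne_zero_of_modeSum_ne_zero`);
* consequently non-degeneracy `S ≠ 0` propagates along adjacency in `Λ` (`modeSum_ne_zero_of_adj`)
  and holds at the source face, where `F(a) = 1` (`modeSum_source_ne_zero`).

**Why.** These are the inputs of the combinatorial Gauss–Bonnet proof of `NoBranching` (the PL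
developing map has local degree one at every interior hexagon): every face of the source component is
a non-degenerate, positively oriented image triangle (corner angles: companion file
`SAWSpinMonotoneQCIdentificationNoBranchingCorners`). Registered entry points (∀-telescopes, prefix
`nb_`): `nb_fobs_eq_zero_of_modeSum_eq_zero`, `nb_fobs_ne_zero_of_modeSum_ne_zero`,
`nb_modeSum_ne_zero_of_adj`.

Sources: H. Duminil-Copin, S. Smirnov, *The connective constant of the honeycomb lattice equals
`√(2+√2)`*, Ann. of Math. 175 (2012) 1653–1665 (arXiv:1007.0575), Lemma 1; the stub report
`STUB-REPORT-noBranching.md` of this line (§2, S1/S1').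
-/

noncomputable section

open Complex
open Literature.Probability.LatticeModels Literature.Probability.RandomPlanarGeometry.SAW
open Summit.CriticalPhenomena.SAWScalingLimit.Theses.SAWDevelopingMap

namespace Summit.CriticalPhenomena.SAWScalingLimit.Cruxes.QCIdentification.EightFifthsPrimitive

namespace NB

/-- The cube root of unity `ω = e^{2πi/3}` of the route statement (K). -/
def omg : ℂ := Complex.exp (2 * Real.pi * I / 3)

/-- `1 + ω + ω² = 0`. -/
theorem one_add_omg_add_sq : 1 + omg + omg ^ 2 = 0 := by
  have h := (Complex.isPrimitiveRoot_exp 3 (by norm_num)).geom_sum_eq_zero (by norm_num : 1 < 3)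
  simpa [Finset.sum_range_succ, omg, add_assoc] using h

/-- `ω³ = 1`. -/
theorem omg_pow_three : omg ^ 3 = 1 := by
  have h := (Complex.isPrimitiveRoot_exp 3 (by norm_num)).pow_eq_one
  simpa [omg] using h

/-- Mode inversion, first value: `3F₀ = S + L + B`. -/
theorem three_mul_eq₀ (F₀ F₁ F₂ : ℂ) :
    3 * F₀ = (F₀ + F₁ + F₂) + (F₀ + omg * F₁ + omg ^ 2 * F₂) + (F₀ + omg * F₂ + omg ^ 2 * F₁) := by
  linear_combination (-(F₁ + F₂)) * one_add_omg_add_sq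

/-- Mode inversion, second value: `3F₁ = S + ω²L + ωB`. -/
theorem three_mul_eq₁ (F₀ F₁ F₂ : ℂ) :
    3 * F₁ = (F₀ + F₁ + F₂) + omg ^ 2 * (F₀ + omg * F₁ + omg ^ 2 * F₂) +
      omg * (F₀ + omg * F₂ + omg ^ 2 * F₁) := by
  linear_combination (-(F₀ + F₂)) * one_add_omg_add_sq - (2 * F₁ + omg * F₂) * omg_pow_three

/-- Mode inversion, third value: `3F₂ = S + ωL + ω²B`. -/
theorem three_mul_eq₂ (F₀ F₁ F₂ : ℂ) :
    3 * F₂ = (F₀ + F₁ + F₂) + omg * (F₀ + omg * F₁ + omg ^ 2 * F₂) +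
      omg ^ 2 * (F₀ + omg * F₂ + omg ^ 2 * F₁) := by
  linear_combination (-(F₀ + F₁)) * one_add_omg_add_sq - (omg * F₁ + 2 * F₂) * omg_pow_three

/-- **Degenerate faces are flat zero under (K).** If both labelled Beltrami quotients are bounded by
the `∂H`-mode and the `∂H`-mode vanishes, all three values vanish. -/
theorem eq_zero_of_modes {F₀ F₁ F₂ : ℂ} {k : ℝ}
    (hL : ‖F₀ + omg * F₁ + omg ^ 2 * F₂‖ ≤ k * ‖F₀ + F₁ + F₂‖)
    (hB : ‖F₀ + omg * F₂ + omg ^ 2 * F₁‖ ≤ k * ‖F₀ + F₂ + F₁‖)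
    (hS : F₀ + F₁ + F₂ = 0) : F₀ = 0 ∧ F₁ = 0 ∧ F₂ = 0 := by
  have hS' : F₀ + F₂ + F₁ = 0 := by rw [← hS]; ring
  rw [hS, norm_zero, mul_zero] at hL
  rw [hS', norm_zero, mul_zero] at hB
  have hL0 : F₀ + omg * F₁ + omg ^ 2 * F₂ = 0 := norm_le_zero_iff.1 hL
  have hB0 : F₀ + omg * F₂ + omg ^ 2 * F₁ = 0 := norm_le_zero_iff.1 hB
  have h₀ := three_mul_eq₀ F₀ F₁ F₂
  have h₁ := three_mul_eq₁ F₀ F₁ F₂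
  have h₂ := three_mul_eq₂ F₀ F₁ F₂
  rw [hS, hL0, hB0] at h₀ h₁ h₂
  refine ⟨?_, ?_, ?_⟩
  · have : (3 : ℂ) * F₀ = 0 := by rw [h₀]; ring
    simpa using this
  · have : (3 : ℂ) * F₁ = 0 := by rw [h₁]; ring
    simpa using this
  · have : (3 : ℂ) * F₂ = 0 := by rw [h₂]; ring
    simpa using this

/-- The explicit neighbours are neighbours. -/
theorem adj_hexNbr (v : HexVertex) (j : Fin 3) : hexGraph.Adj v (hexNbr v j) := by
  obtain ⟨x, s⟩ := v
  have key := hexGraph_adj_iff_of_snd_eq_zero_holds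
  fin_cases s <;> fin_cases j
  · exact (key x x).2 (Or.inl rfl)
  · exact (key x (x - Pi.single 0 1)).2 (Or.inr (Or.inl rfl))
  · exact (key x (x - Pi.single 1 1)).2 (Or.inr (Or.inr rfl))
  · exact ((key x x).2 (Or.inl rfl)).symm
  · exact ((key (x + Pi.single 0 1) x).2 (Or.inr (Or.inl (by simp)))).symm
  · exact ((key (x + Pi.single 1 1) x).2 (Or.inr (Or.inr (by simp)))).symm

/-- The explicit neighbours are pairwise distinct. -/
theorem hexNbr_ne (v : HexVertex) {i j : Fin 3} (hij : i ≠ j) : hexNbr v i ≠ hexNbr v j := by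
  obtain ⟨x, s⟩ := v
  intro h
  apply hij
  fin_cases s <;> fin_cases i <;> fin_cases j <;> first
    | rfl
    | (exfalso
       simp [hexNbr, Prod.ext_iff, funext_iff, Fin.forall_fin_two] at h
       try omega)

/-- **S1 in the vocabulary of the line.** Under `NoFoldBound`, a face of a simply connected domain
whose `∂H`-mode vanishes carries `F = 0` on its three mid-edges. -/
theorem fobs_eq_zero_of_modeSum_eq_zero (hK : NoFoldBound) {Λ : Finset HexVertex}
    (hΛ : hexDomainSimplyConnected Λ) {a : Sym2 HexVertex} (ha : a ∈ hexDomainBoundary Λ)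
    {v : HexVertex} (hv : v ∈ Λ) (h0 : modeSum (Fobs Λ a) v = 0) (j : Fin 3) :
    Fobs Λ a s(v, hexNbr v j) = 0 := by
  obtain ⟨k, -, hk⟩ := hK
  have h01 : hexNbr v 0 ≠ hexNbr v 1 := hexNbr_ne v (by decide)
  have h12 : hexNbr v 1 ≠ hexNbr v 2 := hexNbr_ne v (by decide)
  have h02 : hexNbr v 0 ≠ hexNbr v 2 := hexNbr_ne v (by decide)
  have hL := hk Λ hΛ a ha v hv (hexNbr v 0) (hexNbr v 1) (hexNbr v 2) (adj_hexNbr v 0)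
    (adj_hexNbr v 1) (adj_hexNbr v 2) h01 h12 h02
  have hB := hk Λ hΛ a ha v hv (hexNbr v 0) (hexNbr v 2) (hexNbr v 1) (adj_hexNbr v 0)
    (adj_hexNbr v 2) (adj_hexNbr v 1) h02 h12.symm h01
  simp only at hL hB
  have h := eq_zero_of_modes (F₀ := Fobs Λ a s(v, hexNbr v 0)) (F₁ := Fobs Λ a s(v, hexNbr v 1))
    (F₂ := Fobs Λ a s(v, hexNbr v 2)) (k := k) hL hB h0
  fin_cases j
  · exact h.1
  · exact h.2.1
  · exact h.2.2


/-! ### Lattice geometry of the darts: `mid(p_k) - c(v) = c₀(v) · ω^k` -/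

/-- `ω = ζ²` (`ζ = e^{iπ/3}`). -/
theorem omg_eq_triZeta_sq : omg = triZeta ^ 2 := by
  rw [omg, triZeta, sq, ← Complex.exp_add]
  congr 1
  ring

/-- `ω = -1/2 + (√3/2) i`. -/
theorem omg_eq : omg = ⟨-1 / 2, Real.sqrt 3 / 2⟩ := by
  have h3 : Real.sqrt 3 * Real.sqrt 3 = 3 := Real.mul_self_sqrt (by norm_num)
  rw [omg_eq_triZeta_sq, triZeta_eq, sq]
  apply Complex.ext
  · simp only [Complex.mul_re]
    nlinarith [h3]
  · simp only [Complex.mul_im]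
    ring

/-- `‖ω‖ = 1`. -/
theorem norm_omg : ‖omg‖ = 1 := by
  have h : (2 * ↑Real.pi * I / 3 : ℂ) = ↑(2 * Real.pi / 3 : ℝ) * I := by push_cast; ring
  rw [omg, h, Complex.norm_exp_ofReal_mul_I]

/-- The dart coefficient `c₀(v)`: `(1 + ζ)/6` on up faces, `-(1 + ζ)/6` on down faces. -/
def dartCoeff (v : HexVertex) : ℂ := if v.2 = 0 then (1 + triZeta) / 6 else -(1 + triZeta) / 6

/-- `c₀(v) ≠ 0`. -/
theorem dartCoeff_ne_zero (v : HexVertex) : dartCoeff v ≠ 0 := by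
  have hz : (1 + triZeta : ℂ) ≠ 0 := by
    intro h
    have := congrArg Complex.re h
    rw [triZeta_eq] at this
    norm_num at this
  unfold dartCoeff
  split_ifs
  · exact div_ne_zero hz (by norm_num)
  · exact div_ne_zero (neg_ne_zero.2 hz) (by norm_num)

/-- **The mid-edge offsets are `c₀(v) ω^k`** (counterclockwise labelling `hexNbr`). -/
theorem hexMidpoint_sub_hexCenter (v : HexVertex) (k : Fin 3) :
    hexMidpoint s(v, hexNbr v k) - hexCenter v = dartCoeff v * omg ^ (k : ℕ) := by
  have h3 : Real.sqrt 3 * Real.sqrt 3 = 3 := Real.mul_self_sqrt (by norm_num)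
  have h33 : Real.sqrt 3 * (Real.sqrt 3 * Real.sqrt 3) = Real.sqrt 3 * 3 := by rw [h3]
  obtain ⟨x, s⟩ := v
  fin_cases s <;> fin_cases k <;>
    simp [hexMidpoint_mk, hexCenter, hexNbr, dartCoeff, triEmbed_sub, triEmbed_add, omg_eq,
      triZeta_eq, Complex.ext_iff, pow_succ, Complex.mul_re, Complex.mul_im] <;>
    (constructor <;> nlinarith [h3, h33])

/-- **Lemma 1 as the vanishing of the `ω`-mode**: `F₀ + ωF₁ + ω²F₂ = 0` at every vertex of a simply
connected domain with boundary source (DCS 2012 Lemma 1, tree theorem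
`DuminilCopinSmirnov2012_lemma1_holds`). -/
theorem lemma1_mode {Λ : Finset HexVertex} (hΛ : hexDomainSimplyConnected Λ) {a : Sym2 HexVertex}
    (ha : a ∈ hexDomainBoundary Λ) {v : HexVertex} (hv : v ∈ Λ) :
    Fobs Λ a s(v, hexNbr v 0) + omg * Fobs Λ a s(v, hexNbr v 1) +
      omg ^ 2 * Fobs Λ a s(v, hexNbr v 2) = 0 := by
  have h := DuminilCopinSmirnov2012_lemma1_holds Λ hΛ a ha v hv (hexNbr v 0) (hexNbr v 1)
    (hexNbr v 2) (adj_hexNbr v 0) (adj_hexNbr v 1) (adj_hexNbr v 2) (hexNbr_ne v (by decide))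
    (hexNbr_ne v (by decide)) (hexNbr_ne v (by decide))
  rw [hexMidpoint_sub_hexCenter, hexMidpoint_sub_hexCenter, hexMidpoint_sub_hexCenter] at h
  have hc := dartCoeff_ne_zero v
  have h' : dartCoeff v * (Fobs Λ a s(v, hexNbr v 0) + omg * Fobs Λ a s(v, hexNbr v 1) +
      omg ^ 2 * Fobs Λ a s(v, hexNbr v 2)) = 0 := by
    rw [← h]
    simp only [Fobs, hexCriticalFugacity, Fin.val_zero, Fin.val_one, Fin.val_two, pow_zero, pow_one]
    ring
  exact (mul_eq_zero.1 h').resolve_left hc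

/-- **Non-degenerate faces have no vanishing mid-edge value under (K).** -/
theorem fobs_ne_zero_of_modeSum_ne_zero (hK : NoFoldBound) {Λ : Finset HexVertex}
    (hΛ : hexDomainSimplyConnected Λ) {a : Sym2 HexVertex} (ha : a ∈ hexDomainBoundary Λ)
    {v : HexVertex} (hv : v ∈ Λ) (hS : modeSum (Fobs Λ a) v ≠ 0) (j : Fin 3) :
    Fobs Λ a s(v, hexNbr v j) ≠ 0 := by
  obtain ⟨k, hk1, hk⟩ := hK
  have hB := hk Λ hΛ a ha v hv (hexNbr v 0) (hexNbr v 2) (hexNbr v 1) (adj_hexNbr v 0)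
    (adj_hexNbr v 2) (adj_hexNbr v 1) (hexNbr_ne v (by decide)) (hexNbr_ne v (by decide))
    (hexNbr_ne v (by decide))
  simp only at hB
  change ‖Fobs Λ a s(v, hexNbr v 0) + omg * Fobs Λ a s(v, hexNbr v 2) +
      omg ^ 2 * Fobs Λ a s(v, hexNbr v 1)‖ ≤
    k * ‖Fobs Λ a s(v, hexNbr v 0) + Fobs Λ a s(v, hexNbr v 2) + Fobs Λ a s(v, hexNbr v 1)‖ at hB
  set F₀ := Fobs Λ a s(v, hexNbr v 0) with hF₀
  set F₁ := Fobs Λ a s(v, hexNbr v 1) with hF₁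
  set F₂ := Fobs Λ a s(v, hexNbr v 2) with hF₂
  have hL : F₀ + omg * F₁ + omg ^ 2 * F₂ = 0 := lemma1_mode hΛ ha hv
  have hS' : modeSum (Fobs Λ a) v = F₀ + F₁ + F₂ := rfl
  rw [hS'] at hS
  have hperm : F₀ + F₂ + F₁ = F₀ + F₁ + F₂ := by ring
  rw [hperm] at hB
  -- if `F_j = 0` then `S = -ω^j B'`, so `‖S‖ = ‖B'‖ ≤ k ‖S‖ < ‖S‖`
  have key : ∀ c : ℂ, ‖c‖ = 1 →
      F₀ + F₁ + F₂ = c * (F₀ + omg * F₂ + omg ^ 2 * F₁) → False := by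
    intro c hc h
    have hn : ‖F₀ + F₁ + F₂‖ = ‖F₀ + omg * F₂ + omg ^ 2 * F₁‖ := by rw [h, norm_mul, hc, one_mul]
    have hpos : 0 < ‖F₀ + F₁ + F₂‖ := norm_pos_iff.2 hS
    rw [← hn] at hB
    nlinarith
  have h₀ := three_mul_eq₀ F₀ F₁ F₂
  have h₁ := three_mul_eq₁ F₀ F₁ F₂
  have h₂ := three_mul_eq₂ F₀ F₁ F₂
  rw [hL] at h₀ h₁ h₂
  intro hj
  fin_cases j
  · refine key (-1) (by simp) ?_
    have : F₀ = 0 := hj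
    linear_combination (-1 : ℂ) * h₀ + 3 * this
  · refine key (-omg) (by simp [norm_omg]) ?_
    have : F₁ = 0 := hj
    linear_combination (-1 : ℂ) * h₁ + 3 * this
  · refine key (-omg ^ 2) (by simp [norm_omg]) ?_
    have : F₂ = 0 := hj
    linear_combination (-1 : ℂ) * h₂ + 3 * this


/-! ### Propagation of non-degeneracy along adjacency -/

/-- Every neighbour of a face is one of its three explicit neighbours. -/
theorem exists_hexNbr_eq {v w : HexVertex} (h : hexGraph.Adj v w) : ∃ j : Fin 3, hexNbr v j = w := by
  obtain ⟨x, s⟩ := v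
  obtain ⟨y, t⟩ := w
  have key := hexGraph_adj_iff_of_snd_eq_zero_holds
  have bip := not_hexGraph_adj_of_snd_eq_holds
  fin_cases s <;> fin_cases t
  · exact absurd h (bip _ _ rfl)
  · rcases (key x y).1 h with rfl | rfl | rfl
    · exact ⟨0, rfl⟩
    · exact ⟨1, rfl⟩
    · exact ⟨2, rfl⟩
  · rcases (key y x).1 h.symm with rfl | rfl | rfl
    · exact ⟨0, rfl⟩
    · exact ⟨1, by simp [hexNbr]⟩
    · exact ⟨2, by simp [hexNbr]⟩
  · exact absurd h (bip _ _ rfl)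

/-- **Non-degeneracy propagates to neighbours (under (K)).** Hence, by induction along paths, every
face of the `ℍ[Λ]`-component of the source face is non-degenerate. -/
theorem modeSum_ne_zero_of_adj (hK : NoFoldBound) {Λ : Finset HexVertex}
    (hΛ : hexDomainSimplyConnected Λ) {a : Sym2 HexVertex} (ha : a ∈ hexDomainBoundary Λ)
    {v w : HexVertex} (hv : v ∈ Λ) (hw : w ∈ Λ) (hadj : hexGraph.Adj v w)
    (hS : modeSum (Fobs Λ a) v ≠ 0) : modeSum (Fobs Λ a) w ≠ 0 := by
  obtain ⟨j, rfl⟩ := exists_hexNbr_eq hadj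
  have hF := fobs_ne_zero_of_modeSum_ne_zero hK hΛ ha hv hS j
  intro hw0
  obtain ⟨j', hj'⟩ := exists_hexNbr_eq hadj.symm
  have h0 := fobs_eq_zero_of_modeSum_eq_zero hK hΛ ha hw hw0 j'
  rw [hj', Sym2.eq_swap] at h0
  exact hF h0

/-- **The source face is non-degenerate**: `F(a) = 1 ≠ 0` sits on one of its mid-edges. -/
theorem modeSum_source_ne_zero (hK : NoFoldBound) {Λ : Finset HexVertex}
    (hΛ : hexDomainSimplyConnected Λ) {ua va : HexVertex} (hva : va ∈ Λ) (hua : ua ∉ Λ)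
    (hadj : hexGraph.Adj va ua) : modeSum (Fobs Λ s(ua, va)) va ≠ 0 := by
  have ha : s(ua, va) ∈ hexDomainBoundary Λ :=
    ⟨(SimpleGraph.mem_edgeSet hexGraph).2 hadj.symm, ua, va, rfl, hva, hua⟩
  intro h0
  obtain ⟨j, hj⟩ := exists_hexNbr_eq hadj
  have h := fobs_eq_zero_of_modeSum_eq_zero hK hΛ ha hva h0 j
  rw [hj, show s(va, ua) = s(ua, va) from Sym2.eq_swap] at h
  -- `F(a) = 1`: the only walk `a → a` is the trivial one
  have h1 : Fobs Λ s(ua, va) s(ua, va) = 1 := by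
    simp only [Fobs, hexParafermionicObservable]
    have hmem : s(ua, va) ∈ hexDomainMidEdges Λ := hexDomainBoundary_subset Λ ha
    have huniq : ∀ γ : HexMidEdgeSAW Λ s(ua, va) s(ua, va), γ = HexMidEdgeSAW.trivial hmem :=
      fun γ => HexMidEdgeSAW.ext (HexMidEdgeSAW.verts_eq_nil_of_mem_boundary ha γ)
    have : (Finset.univ : Finset (HexMidEdgeSAW Λ s(ua, va) s(ua, va))) =
        {HexMidEdgeSAW.trivial hmem} := by
      ext γ
      simp [huniq γ]
    rw [this, Finset.sum_singleton, HexMidEdgeSAW.weight_trivial]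
  rw [h1] at h
  exact one_ne_zero h

/-! ### Registered entry points (∀-telescopes) -/

/-- **S1 (registered form).** Under `NoFoldBound`, in a simply connected domain with boundary source, a
face whose `∂H`-mode vanishes carries `F = 0` on its three mid-edges. -/
theorem nb_fobs_eq_zero_of_modeSum_eq_zero : NoFoldBound → ∀ {Λ : Finset HexVertex}, hexDomainSimplyConnected Λ → ∀ {a : Sym2 HexVertex}, a ∈ hexDomainBoundary Λ → ∀ {v : HexVertex}, v ∈ Λ → modeSum (Fobs Λ a) v = 0 → ∀ j : Fin 3, Fobs Λ a s(v, hexNbr v j) = 0 :=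
  fun hK _ hΛ _ ha _ hv h0 j => fobs_eq_zero_of_modeSum_eq_zero hK hΛ ha hv h0 j

/-- **S1, non-degenerate faces (registered form).** Under `NoFoldBound`, a face with non-vanishing
`∂H`-mode has no vanishing mid-edge value. -/
theorem nb_fobs_ne_zero_of_modeSum_ne_zero : NoFoldBound → ∀ {Λ : Finset HexVertex}, hexDomainSimplyConnected Λ → ∀ {a : Sym2 HexVertex}, a ∈ hexDomainBoundary Λ → ∀ {v : HexVertex}, v ∈ Λ → modeSum (Fobs Λ a) v ≠ 0 → ∀ j : Fin 3, Fobs Λ a s(v, hexNbr v j) ≠ 0 :=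
  fun hK _ hΛ _ ha _ hv hS j => fobs_ne_zero_of_modeSum_ne_zero hK hΛ ha hv hS j

/-- **S1', propagation (registered form).** Under `NoFoldBound`, non-degeneracy of the `∂H`-mode
passes to every `Λ`-neighbour. -/
theorem nb_modeSum_ne_zero_of_adj : NoFoldBound → ∀ {Λ : Finset HexVertex}, hexDomainSimplyConnected Λ → ∀ {a : Sym2 HexVertex}, a ∈ hexDomainBoundary Λ → ∀ {v w : HexVertex}, v ∈ Λ → w ∈ Λ → hexGraph.Adj v w → modeSum (Fobs Λ a) v ≠ 0 → modeSum (Fobs Λ a) w ≠ 0 :=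
  fun hK _ hΛ _ ha _ _ hv hw hadj hS => modeSum_ne_zero_of_adj hK hΛ ha hv hw hadj hS

end NB

end Summit.CriticalPhenomena.SAWScalingLimit.Cruxes.QCIdentification.EightFifthsPrimitive
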